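import Literature.NumberTheory.EllipticCurves.FineSelmerPointLineFieldMuRoad
import Literature.NumberTheory.IwasawaTheory.ClassGroupPRankSmallRankCriterion
import HarnessLib

/-!
# Coates–Sujatha's statement (A) from ONE small `p`-rank along the cyclotomic tower of a `p′`-fixed field `K̄^Θ`
# (`Gal(K̄/K(E[p])) ≤ Θ ≤ Stab P`, `p ∤ #res Θ`) and of the point–line field `K(P, ⟨Q⟩)` (image-free; proved)

`Proofs`-style file (theorems only: no definition, no named fact, no `sorry`) in topic `NumberTheory/EllipticCurves`
(namespace `Literature.NumberTheory.EllipticCurves.CoatesSujatha2005`), written by the literature seat `bsd-potss-conjA-anchor` g20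
(cell `bsd-potss`; serves the asides stmt-BirchSwinnertonDyer-19386 / 19413; closes nothing; (A) is proved for no particular curve).
It composes the seat's door L9 (`FineSelmerFixedFieldMuRoad`, `FineSelmerPointLineFieldMuRoad`: for `p` odd, `E[p]` irreducible, any
subgroup `Θ` between `Gal(K̄/K(E[p]))` and `Stab(P)` whose image in `Gal(K(E[p])/K)` has order prime to `p`, bounded `p`-ranks along a
cyclotomic `ℤ_p`-tower of `F = K̄^Θ` give (A); `Θ = Stab P ⊓ Stab ⟨Q⟩` needs NO image hypothesis) with the seat's door L10
(`IwasawaTheory/ClassGroupPRankSmallRankCriterion`: `TotallyRamifiedFrom κ_F n₀`, `n₀ ≤ n`, `rank_p Cl(F_{n+j}) < p^j - 1` for ONE `j` ⟹ the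
`p`-ranks of all layers are bounded):

* §1 `conjA_of_classGroupPRank_fixedField_lt_pow_sub_one`, `conjA_of_classNumberPExp_fixedField_succ_le` (general `Θ`);
* §2 `conjA_of_classGroupPRank_pointLineField_lt_pow_sub_one`, `conjA_of_classNumberPExp_pointLineField_succ_le`,
  `conjA_of_forall_classNumberPExp_pointLineField_succ_le` (`Θ = Stab P ⊓ Stab ⟨Q⟩`, binder-free in `P, Q` in the last).
`p = 3`, `K = ℚ`, a `GL₂(𝔽₃)`-image curve, `n₀ = 0`: **`ord₃ h` of the first cyclotomic layer (degree `72`) of `ℚ(P, x(Q))` (degree `24`)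
at most `1` ⟹ (A)**, with no hypothesis on `ρ̄_{E,3}` beyond irreducibility.

References: [CoatesSujatha2005] §3 Thm. 3.4, Lemma 3.8; [DeoRaySujatha2023] §5 Lemma 5.1; [Washington1997] §13.3 Prop. 13.22–13.23;
[Fukuda1994] Thm. 1 (proof, p. 264); [Lang1990] Ch. 13 §1 Lemma 3.
-/

set_option autoImplicit false

noncomputable section

open scoped Classical Pointwise NumberField
open NumberField Field IntermediateField

namespace Literature.NumberTheory.EllipticCurves.CoatesSujatha2005

open WeierstrassCurve Literature.NumberTheory.IwasawaTheory Literature.NumberTheory.GaloisRepresentations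
  Literature.NumberTheory.EllipticCurves Literature.NumberTheory.EllipticCurves.ZpExtension
  Literature.NumberTheory.EllipticCurves.FineSelmerStabilizerDescent

variable {K : Type} [Field K] [NumberField K] (W : WeierstrassCurve K) [W.IsElliptic] {p : ℕ} [Fact p.Prime]

/-! ## §1 General `p′`-fixed field `F = K̄^Θ` -/

/-- **(A) from ONE small `p`-rank along the cyclotomic tower of `F = K̄^Θ`** (door L9 ∘ door L10): `p` odd, `E[p]` irreducible,
`Gal(K̄/K(E[p])) ≤ Θ ≤ Stab(P)` (`P ≠ 0`) with `p ∤ #res_{K(E[p])}(Θ)`; if every cyclotomic `ℤ_p`-extension `κ_F` of `F` has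
`TotallyRamifiedFrom κ_F n₀` and `rank_p Cl(F_{n+j}) < p^j - 1` (`n ≥ n₀`), then statement (A) holds for `E` at `p` over `K_∞`.
[cite: CoatesSujatha2005, §3 Thm. 3.4 and Lemma 3.8] [cite: DeoRaySujatha2023, §5 Lemma 5.1] [cite: Washington1997, §13.3 Prop. 13.22–13.23]
[cite: Fukuda1994, Thm. 1 (proof, p. 264)] -/
theorem conjA_of_classGroupPRank_fixedField_lt_pow_sub_one (hp : p ≠ 2) (hirr : W.HasIrreducibleModPGaloisRep p)
    (Θ : Subgroup (absoluteGaloisGroup K)) (hNΘ : fixingSubgroupOfModule K ↥(W.geomTorsion (p : ℤ)) ≤ Θ)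
    (P : ↥(W.geomTorsion (p : ℤ))) (hP0 : P ≠ 0)
    (hΘP : Θ ≤ MulAction.stabilizer (absoluteGaloisGroup K) P)
    (hH : haveI : NeZero p := ⟨(Fact.out : p.Prime).ne_zero⟩
      ¬ p ∣ Nat.card ↥(Θ.map (absRestrictNormalHom (W.divisionField p))))
    {n₀ n j : ℕ} (hn : n₀ ≤ n)
    (h : ∀ κF : ZpExtension ↥(fixedField Θ : IntermediateField K (AlgebraicClosure K)) p,
      κF.IsCyclotomic → TotallyRamifiedFrom κF n₀ ∧ classGroupPRank κF (n + j) < p ^ j - 1)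
    (κ : ZpExtension K p) (hκ : κ.IsCyclotomic) :
    ∃ (γ : absoluteGaloisGroup K) (D : W.FineSelmerDualData κ γ),
      Module.Finite ℤ_[p] (RestrictScalars ℤ_[p] (IwasawaAlgebra p) D.X) := by
  have hpr : p.Prime := Fact.out
  haveI : NeZero p := ⟨hpr.ne_zero⟩
  have hN : IsOpen ((fixingSubgroupOfModule K ↥(W.geomTorsion (p : ℤ)) : Subgroup (absoluteGaloisGroup K)) :
      Set (absoluteGaloisGroup K)) := W.isOpen_fixingSubgroupOfModule_geomTorsion p
  have hΘopen : IsOpen (Θ : Set (absoluteGaloisGroup K)) := Subgroup.isOpen_mono hNΘ hN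
  haveI : FiniteDimensional K ↥(fixedField Θ : IntermediateField K (AlgebraicClosure K)) :=
    finiteDimensional_fixedField_of_isOpen Θ hΘopen
  haveI : NumberField ↥(fixedField Θ : IntermediateField K (AlgebraicClosure K)) := NumberField.of_module_finite K _
  obtain ⟨a, κF, hs⟩ := exists_zpExtension_shift κ ↥(fixedField Θ : IntermediateField K (AlgebraicClosure K))
  have hκF : κF.IsCyclotomic := isCyclotomic_of_shift κ _ κF hs hκ
  obtain ⟨B, hB⟩ := exists_forall_classGroupPRank_le_of_lt_pow_sub_one κF (h κF hκF).1 hn (h κF hκF).2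
  exact fineSelmerDual_moduleFinite_of_classGroupPRank_fixedField_le W hp hirr Θ hNΘ P hP0 hΘP hH κ hκ B ⟨κF, hκF, hB⟩

/-- **Layer `n₀ + 1` at `F = K̄^Θ`, exponent form — the census shape**: setting of the previous theorem; if every cyclotomic
`ℤ_p`-extension `κ_F` of `F` has `TotallyRamifiedFrom κ_F n₀` and `ord_p h(F_{n₀+1}) ≤ p - 2` (`p = 3`: `≤ 1`), then (A) holds for `E`
at `p` over `K_∞`. [cite: CoatesSujatha2005, §3 Thm. 3.4 and Lemma 3.8] [cite: DeoRaySujatha2023, §5 Lemma 5.1]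
[cite: Washington1997, §13.3 Prop. 13.22–13.23 (with `e_n ≥ rank A_n`)] -/
theorem conjA_of_classNumberPExp_fixedField_succ_le (hp : p ≠ 2) (hirr : W.HasIrreducibleModPGaloisRep p)
    (Θ : Subgroup (absoluteGaloisGroup K)) (hNΘ : fixingSubgroupOfModule K ↥(W.geomTorsion (p : ℤ)) ≤ Θ)
    (P : ↥(W.geomTorsion (p : ℤ))) (hP0 : P ≠ 0)
    (hΘP : Θ ≤ MulAction.stabilizer (absoluteGaloisGroup K) P)
    (hH : haveI : NeZero p := ⟨(Fact.out : p.Prime).ne_zero⟩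
      ¬ p ∣ Nat.card ↥(Θ.map (absRestrictNormalHom (W.divisionField p))))
    {n₀ : ℕ}
    (h : ∀ κF : ZpExtension ↥(fixedField Θ : IntermediateField K (AlgebraicClosure K)) p,
      κF.IsCyclotomic → TotallyRamifiedFrom κF n₀ ∧ classNumberPExp κF (n₀ + 1) ≤ p - 2)
    (κ : ZpExtension K p) (hκ : κ.IsCyclotomic) :
    ∃ (γ : absoluteGaloisGroup K) (D : W.FineSelmerDualData κ γ),
      Module.Finite ℤ_[p] (RestrictScalars ℤ_[p] (IwasawaAlgebra p) D.X) := by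
  have hpr : p.Prime := Fact.out
  haveI : NeZero p := ⟨hpr.ne_zero⟩
  have hN : IsOpen ((fixingSubgroupOfModule K ↥(W.geomTorsion (p : ℤ)) : Subgroup (absoluteGaloisGroup K)) :
      Set (absoluteGaloisGroup K)) := W.isOpen_fixingSubgroupOfModule_geomTorsion p
  have hΘopen : IsOpen (Θ : Set (absoluteGaloisGroup K)) := Subgroup.isOpen_mono hNΘ hN
  haveI : FiniteDimensional K ↥(fixedField Θ : IntermediateField K (AlgebraicClosure K)) :=
    finiteDimensional_fixedField_of_isOpen Θ hΘopen
  haveI : NumberField ↥(fixedField Θ : IntermediateField K (AlgebraicClosure K)) := NumberField.of_module_finite K _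
  have hp1 : p - 2 < p ^ 1 - 1 := by have := hpr.two_le; rw [pow_one]; omega
  exact conjA_of_classGroupPRank_fixedField_lt_pow_sub_one W hp hirr Θ hNΘ P hP0 hΘP hH (n := n₀) (j := 1) le_rfl
    (fun κF hκF => ⟨(h κF hκF).1,
      lt_of_le_of_lt (classGroupPRank_le_classNumberPExp κF _) (lt_of_le_of_lt (h κF hκF).2 hp1)⟩) κ hκ

/-! ## §2 The point–line field `K(P, ⟨Q⟩)` (no image hypothesis) -/

/-- **(A) from ONE small `p`-rank along the cyclotomic tower of the point–line field `K(P,⟨Q⟩) = K̄^{Stab P ⊓ Stab ⟨Q⟩}`**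
(door L9 at the point–line field ∘ door L10): `p` odd, `E[p]` irreducible, `P ≠ 0`, `Q ∉ ⟨P⟩`; if every cyclotomic `ℤ_p`-extension
`κ'` of `K(P,⟨Q⟩)` has `TotallyRamifiedFrom κ' n₀` and `rank_p Cl(K(P,⟨Q⟩)_{n+j}) < p^j - 1` (`n ≥ n₀`), then (A) holds for `E` at `p`
over `K_∞`.  NO hypothesis on the image of `ρ̄_{E,p}`. [cite: CoatesSujatha2005, §3 Thm. 3.4 and Lemma 3.8]
[cite: DeoRaySujatha2023, §5 Lemma 5.1] [cite: Washington1997, §13.3 Prop. 13.22–13.23] [cite: Fukuda1994, Thm. 1 (proof, p. 264)] -/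
theorem conjA_of_classGroupPRank_pointLineField_lt_pow_sub_one (hp : p ≠ 2) (hirr : W.HasIrreducibleModPGaloisRep p)
    (P Q : ↥(W.geomTorsion (p : ℤ))) (hP0 : P ≠ 0) (hQ : Q ∉ AddSubgroup.zmultiples P) {n₀ n j : ℕ} (hn : n₀ ≤ n)
    (h : ∀ κ' : ZpExtension ↥(fixedField (MulAction.stabilizer (absoluteGaloisGroup K) P ⊓
        MulAction.stabilizer (absoluteGaloisGroup K) (AddSubgroup.zmultiples Q)) :
          IntermediateField K (AlgebraicClosure K)) p,
      κ'.IsCyclotomic → TotallyRamifiedFrom κ' n₀ ∧ classGroupPRank κ' (n + j) < p ^ j - 1)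
    (κ : ZpExtension K p) (hκ : κ.IsCyclotomic) :
    ∃ (γ : absoluteGaloisGroup K) (D : W.FineSelmerDualData κ γ),
      Module.Finite ℤ_[p] (RestrictScalars ℤ_[p] (IwasawaAlgebra p) D.X) := by
  haveI : NeZero p := ⟨(Fact.out : p.Prime).ne_zero⟩
  exact conjA_of_classGroupPRank_fixedField_lt_pow_sub_one W hp hirr _
    (fixingSubgroupOfModule_le_stabilizer_inf_stabilizer_zmultiples W P Q) P hP0 inf_le_left
    (not_dvd_natCard_map_stabilizer_inf_stabilizer_zmultiples W P Q hP0 hQ) hn h κ hκ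

/-- **Layer `n₀ + 1` at the point–line field, exponent form**: `p` odd, `E[p]` irreducible, `P ≠ 0`, `Q ∉ ⟨P⟩`; if every cyclotomic
`ℤ_p`-extension `κ'` of `K(P,⟨Q⟩)` has `TotallyRamifiedFrom κ' n₀` and `ord_p h(K(P,⟨Q⟩)_{n₀+1}) ≤ p - 2`, then (A) holds for `E` at `p`.
[cite: CoatesSujatha2005, §3 Thm. 3.4 and Lemma 3.8] [cite: DeoRaySujatha2023, §5 Lemma 5.1] [cite: Washington1997, §13.3 Prop. 13.22–13.23] -/
theorem conjA_of_classNumberPExp_pointLineField_succ_le (hp : p ≠ 2) (hirr : W.HasIrreducibleModPGaloisRep p)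
    (P Q : ↥(W.geomTorsion (p : ℤ))) (hP0 : P ≠ 0) (hQ : Q ∉ AddSubgroup.zmultiples P) {n₀ : ℕ}
    (h : ∀ κ' : ZpExtension ↥(fixedField (MulAction.stabilizer (absoluteGaloisGroup K) P ⊓
        MulAction.stabilizer (absoluteGaloisGroup K) (AddSubgroup.zmultiples Q)) :
          IntermediateField K (AlgebraicClosure K)) p,
      κ'.IsCyclotomic → TotallyRamifiedFrom κ' n₀ ∧ classNumberPExp κ' (n₀ + 1) ≤ p - 2)
    (κ : ZpExtension K p) (hκ : κ.IsCyclotomic) :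
    ∃ (γ : absoluteGaloisGroup K) (D : W.FineSelmerDualData κ γ),
      Module.Finite ℤ_[p] (RestrictScalars ℤ_[p] (IwasawaAlgebra p) D.X) := by
  haveI : NeZero p := ⟨(Fact.out : p.Prime).ne_zero⟩
  exact conjA_of_classNumberPExp_fixedField_succ_le W hp hirr _
    (fixingSubgroupOfModule_le_stabilizer_inf_stabilizer_zmultiples W P Q) P hP0 inf_le_left
    (not_dvd_natCard_map_stabilizer_inf_stabilizer_zmultiples W P Q hP0 hQ) h κ hκ

/-- **Binder-free form** (a point–line pair exists since `#E[p] = p² > p`; on a `GL₂(𝔽_p)`-image curve all point–line pairs are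
conjugate, so the datum is ONE class number): `p` odd, `E[p]` irreducible; if for EVERY `P ≠ 0`, `Q ∉ ⟨P⟩` and every cyclotomic
`ℤ_p`-extension `κ'` of `K(P,⟨Q⟩)`, `TotallyRamifiedFrom κ' n₀` and `ord_p h(K(P,⟨Q⟩)_{n₀+1}) ≤ p - 2`, then (A) holds for `E` at `p`.
`K = ℚ`, `p = 3`, surjective `ρ̄_{E,3}`, `n₀ = 0`: `ord₃ h ≤ 1` for the first cyclotomic layer (degree `72`) of `ℚ(P, x(Q))`.
[cite: CoatesSujatha2005, §3 Thm. 3.4 and Lemma 3.8] [cite: DeoRaySujatha2023, §5 Lemma 5.1] [cite: Washington1997, §13.3 Prop. 13.22–13.23] -/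
theorem conjA_of_forall_classNumberPExp_pointLineField_succ_le (hp : p ≠ 2) (hirr : W.HasIrreducibleModPGaloisRep p) {n₀ : ℕ}
    (h : ∀ P Q : ↥(W.geomTorsion (p : ℤ)), P ≠ 0 → Q ∉ AddSubgroup.zmultiples P →
      ∀ κ' : ZpExtension ↥(fixedField (MulAction.stabilizer (absoluteGaloisGroup K) P ⊓
        MulAction.stabilizer (absoluteGaloisGroup K) (AddSubgroup.zmultiples Q)) :
          IntermediateField K (AlgebraicClosure K)) p,
        κ'.IsCyclotomic → TotallyRamifiedFrom κ' n₀ ∧ classNumberPExp κ' (n₀ + 1) ≤ p - 2)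
    (κ : ZpExtension K p) (hκ : κ.IsCyclotomic) :
    ∃ (γ : absoluteGaloisGroup K) (D : W.FineSelmerDualData κ γ),
      Module.Finite ℤ_[p] (RestrictScalars ℤ_[p] (IwasawaAlgebra p) D.X) := by
  haveI : NeZero p := ⟨(Fact.out : p.Prime).ne_zero⟩
  obtain ⟨P, Q, hP0, hQ⟩ := exists_ne_zero_and_not_mem_zmultiples W (p := p)
  exact conjA_of_classNumberPExp_pointLineField_succ_le W hp hirr P Q hP0 hQ (h P Q hP0 hQ) κ hκ

end Literature.NumberTheory.EllipticCurves.CoatesSujatha2005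

end
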